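import Mathlib.MeasureTheory.Integral.IntervalIntegral.IntegrationByParts
import Mathlib.Analysis.SpecialFunctions.Integrals.Basic
import HarnessLib

/-!
# The trapezoid rule with a `C²` error bound, for vector-valued functions

Topic `Literature/Analysis/Calculus`. Everything here is PROVED; no definitions, no named facts.

Mathlib's `trapezoidal_error_le` (`Mathlib/MeasureTheory/Integral/IntervalIntegral/TrapezoidalRule.lean`)
is stated for real-valued functions with `derivWithin`/`iteratedDerivWithin` hypotheses on `[[a, b]]`.
For the asymptotic evaluation of sums `Σᵢ log(κ + i/n)` with complex `κ` (Euler–Maclaurin to first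
order, as needed for the amplitudes in saddle-point estimates of hypergeometric sums) we want the
same bound for functions with values in a real normed space, with pointwise `HasDerivAt`
hypotheses:

* `norm_integral_sub_trapezoid_le` — if `f' = df/dx`, `f'' = df'/dx` on `[a, b]`, `f''` is
  continuous there and `‖f''‖ ≤ ζ`, then `‖∫_a^b f − (b−a)/2 • (f a + f b)‖ ≤ ζ (b − a)³ / 12`
  (two integrations by parts against `x − m` and `(x−m)²/2 − h²/8`, `m` the midpoint, `h = b − a`);
* `norm_trapezoid_sum_le` — the composite rule on a uniform grid `a, a + h, …, a + N h`:
  `‖h • Σ_{i=0}^{N} f(a + ih) − (h/2) • (f a + f(a+Nh)) − ∫_a^{a+Nh} f‖ ≤ N ζ h³ / 12`.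

Classical (e.g. Davis–Rabinowitz, *Methods of Numerical Integration*, §2.1); tagged folklore.
-/

noncomputable section

open Set MeasureTheory intervalIntegral Finset

namespace Literature.Analysis.Calculus

variable {E : Type*} [NormedAddCommGroup E] [NormedSpace ℝ E] [CompleteSpace E]

/-- `∫_a^b (h²/8 − (x − m)²/2) dx = h³/12` for `m = (a+b)/2`, `h = b − a`. [folklore] -/
theorem integral_trapezoid_kernel (a b : ℝ) :
    ∫ x in a..b, ((b - a) ^ 2 / 8 - (x - (a + b) / 2) ^ 2 / 2) = (b - a) ^ 3 / 12 := by
  have hderiv : ∀ x ∈ uIcc a b, HasDerivAt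
      (fun x : ℝ ↦ (b - a) ^ 2 / 8 * x - (x - (a + b) / 2) ^ 3 / 6)
      ((b - a) ^ 2 / 8 - (x - (a + b) / 2) ^ 2 / 2) x := by
    intro x _
    have h1 : HasDerivAt (fun x : ℝ ↦ (b - a) ^ 2 / 8 * x) ((b - a) ^ 2 / 8 * 1) x :=
      (hasDerivAt_id x).const_mul _
    have h2 : HasDerivAt (fun x : ℝ ↦ (x - (a + b) / 2) ^ 3 / 6)
        ((3 : ℕ) * (x - (a + b) / 2) ^ (3 - 1) * 1 / 6) x :=
      (((hasDerivAt_id x).sub_const ((a + b) / 2)).fun_pow 3).div_const 6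
    refine (h1.fun_sub h2).congr_deriv ?_
    norm_num
    ring
  rw [integral_eq_sub_of_hasDerivAt hderiv (Continuous.intervalIntegrable (by fun_prop) _ _)]
  ring

/-- The kernel `h²/8 − (x − m)²/2` is non-negative on `[a, b]`. [folklore] -/
theorem trapezoid_kernel_nonneg {a b x : ℝ} (hx : x ∈ Icc a b) :
    0 ≤ (b - a) ^ 2 / 8 - (x - (a + b) / 2) ^ 2 / 2 := by
  have h1 := hx.1
  have h2 := hx.2
  nlinarith

/-- **Trapezoid rule on one interval, vector-valued, `C²` bound.** If `f` has derivative `f'`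
and `f'` has derivative `f''` at every point of `[a, b]` (`a ≤ b`), `f''` is continuous on
`[a, b]` and `‖f'' x‖ ≤ ζ` there, then
`‖∫_a^b f − ((b − a)/2) • (f a + f b)‖ ≤ ζ (b − a)³/12`. [folklore] -/
theorem norm_integral_sub_trapezoid_le {f f' f'' : ℝ → E} {a b ζ : ℝ} (hab : a ≤ b)
    (hf : ∀ x ∈ Icc a b, HasDerivAt f (f' x) x) (hf' : ∀ x ∈ Icc a b, HasDerivAt f' (f'' x) x)
    (hcont : ContinuousOn f'' (Icc a b)) (hbound : ∀ x ∈ Icc a b, ‖f'' x‖ ≤ ζ) :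
    ‖(∫ x in a..b, f x) - ((b - a) / 2) • (f a + f b)‖ ≤ ζ * (b - a) ^ 3 / 12 := by
  have huIcc : uIcc a b = Icc a b := uIcc_of_le hab
  set m : ℝ := (a + b) / 2 with hm
  -- continuity / integrability
  have hfc : ContinuousOn f (Icc a b) := fun x hx ↦ (hf x hx).continuousAt.continuousWithinAt
  have hf'c : ContinuousOn f' (Icc a b) := fun x hx ↦ (hf' x hx).continuousAt.continuousWithinAt
  have hfi : IntervalIntegrable f volume a b := hfc.intervalIntegrable_of_Icc hab
  have hf'i : IntervalIntegrable f' volume a b := hf'c.intervalIntegrable_of_Icc hab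
  have hf''i : IntervalIntegrable f'' volume a b := hcont.intervalIntegrable_of_Icc hab
  -- first integration by parts: `u = x - m`, `v = f`
  have ibp1 : ∫ x in a..b, (x - m) • f' x =
      (b - m) • f b - (a - m) • f a - ∫ x in a..b, (1 : ℝ) • f x := by
    refine integral_smul_deriv_eq_deriv_smul (u := fun x ↦ x - m) (u' := fun _ ↦ (1 : ℝ))
      (fun x _ ↦ by simpa using (hasDerivAt_id x).sub_const m)
      (fun x hx ↦ hf x (by rwa [huIcc] at hx)) ?_ hf'i
    exact intervalIntegrable_const
  -- second integration by parts: `u = (x-m)²/2 - h²/8`, `v = f'`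
  have ibp2 : ∫ x in a..b, ((x - m) ^ 2 / 2 - (b - a) ^ 2 / 8) • f'' x =
      ((b - m) ^ 2 / 2 - (b - a) ^ 2 / 8) • f' b - ((a - m) ^ 2 / 2 - (b - a) ^ 2 / 8) • f' a -
        ∫ x in a..b, (x - m) • f' x := by
    refine integral_smul_deriv_eq_deriv_smul (u := fun x ↦ (x - m) ^ 2 / 2 - (b - a) ^ 2 / 8)
      (u' := fun x ↦ x - m) (fun x _ ↦ ?_) (fun x hx ↦ hf' x (by rwa [huIcc] at hx)) ?_ hf''i
    · refine (((((hasDerivAt_id x).sub_const m).fun_pow 2).div_const 2).sub_const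
        ((b - a) ^ 2 / 8)).congr_deriv ?_
      norm_num
    · exact (continuous_id.sub continuous_const).intervalIntegrable _ _
  have hbm : (b - m) ^ 2 / 2 - (b - a) ^ 2 / 8 = 0 := by rw [hm]; ring
  have ham : (a - m) ^ 2 / 2 - (b - a) ^ 2 / 8 = 0 := by rw [hm]; ring
  rw [hbm, ham, zero_smul, zero_smul, sub_zero, zero_sub] at ibp2
  -- combine: `∫ f - (h/2)(f a + f b) = ∫ ((x-m)²/2 - h²/8) • f''`
  have hkey : (∫ x in a..b, f x) - ((b - a) / 2) • (f a + f b) =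
      ∫ x in a..b, ((x - m) ^ 2 / 2 - (b - a) ^ 2 / 8) • f'' x := by
    rw [ibp2, ibp1]
    simp only [one_smul]
    rw [hm, smul_add]
    have e1 : (b - (a + b) / 2) = (b - a) / 2 := by ring
    have e2 : (a - (a + b) / 2) = -((b - a) / 2) := by ring
    rw [e1, e2, neg_smul]
    abel
  rw [hkey]
  -- estimate
  have hle : ∀ x ∈ Icc a b, ‖((x - m) ^ 2 / 2 - (b - a) ^ 2 / 8) • f'' x‖ ≤
      ζ * ((b - a) ^ 2 / 8 - (x - (a + b) / 2) ^ 2 / 2) := by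
    intro x hx
    rw [norm_smul, Real.norm_eq_abs, hm]
    have hk := trapezoid_kernel_nonneg hx
    rw [show (x - (a + b) / 2) ^ 2 / 2 - (b - a) ^ 2 / 8 = -((b - a) ^ 2 / 8 - (x - (a + b) / 2) ^ 2 / 2)
      by ring, abs_neg, abs_of_nonneg hk, mul_comm]
    exact mul_le_mul_of_nonneg_right (hbound x hx) hk
  calc ‖∫ x in a..b, ((x - m) ^ 2 / 2 - (b - a) ^ 2 / 8) • f'' x‖
      ≤ ∫ x in a..b, ζ * ((b - a) ^ 2 / 8 - (x - (a + b) / 2) ^ 2 / 2) := by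
        refine norm_integral_le_of_norm_le hab (Filter.Eventually.of_forall fun x hx ↦
          hle x ⟨hx.1.le, hx.2⟩) ?_
        exact (Continuous.intervalIntegrable (by fun_prop) _ _)
    _ = ζ * (b - a) ^ 3 / 12 := by
        rw [intervalIntegral.integral_const_mul, integral_trapezoid_kernel]; ring

/-- **Composite trapezoid rule on a uniform grid.** With `0 ≤ h`, `N : ℕ`, and `f, f', f''` as in
`norm_integral_sub_trapezoid_le` on `[a, a + N h]`:
`‖h • Σ_{i=0}^{N} f(a + ih) − (h/2) • (f a + f(a + Nh)) − ∫_a^{a+Nh} f‖ ≤ N ζ h³ / 12`.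
[folklore] -/
theorem norm_trapezoid_sum_le {f f' f'' : ℝ → E} {a h ζ : ℝ} (hh : 0 ≤ h) (N : ℕ)
    (hf : ∀ x ∈ Icc a (a + N * h), HasDerivAt f (f' x) x)
    (hf' : ∀ x ∈ Icc a (a + N * h), HasDerivAt f' (f'' x) x)
    (hcont : ContinuousOn f'' (Icc a (a + N * h)))
    (hbound : ∀ x ∈ Icc a (a + N * h), ‖f'' x‖ ≤ ζ) :
    ‖h • (∑ i ∈ range (N + 1), f (a + i * h)) - (h / 2) • (f a + f (a + N * h)) -
        ∫ x in a..(a + N * h), f x‖ ≤ N * (ζ * h ^ 3 / 12) := by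
  induction N with
  | zero =>
    simp only [CharP.cast_eq_zero, zero_mul, add_zero, zero_add, range_one, sum_singleton,
      integral_same, sub_zero]
    rw [show h • f a - (h / 2) • (f a + f a) = 0 by rw [smul_add, ← add_smul]; ring_nf; simp]
    simp
  | succ N ih =>
    -- restrict the hypotheses to the shorter interval
    have hsub : Icc a (a + N * h) ⊆ Icc a (a + (N + 1 : ℕ) * h) := by
      refine Icc_subset_Icc le_rfl ?_
      push_cast
      nlinarith
    have ih' := ih (fun x hx ↦ hf x (hsub hx)) (fun x hx ↦ hf' x (hsub hx)) (hcont.mono hsub)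
      (fun x hx ↦ hbound x (hsub hx))
    -- the last panel `[a + N h, a + (N+1) h]`
    have hsub2 : Icc (a + N * h) (a + (N + 1 : ℕ) * h) ⊆ Icc a (a + (N + 1 : ℕ) * h) := by
      refine Icc_subset_Icc ?_ le_rfl
      nlinarith
    have hpan : a + N * h ≤ a + (N + 1 : ℕ) * h := by push_cast; nlinarith
    have hstep := norm_integral_sub_trapezoid_le (f := f) hpan (fun x hx ↦ hf x (hsub2 hx))
      (fun x hx ↦ hf' x (hsub2 hx)) (hcont.mono hsub2) (fun x hx ↦ hbound x (hsub2 hx))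
    have hwidth : a + (N + 1 : ℕ) * h - (a + N * h) = h := by push_cast; ring
    rw [hwidth] at hstep
    -- integrability for splitting the integral
    have hfc : ContinuousOn f (Icc a (a + (N + 1 : ℕ) * h)) := fun x hx ↦
      (hf x hx).continuousAt.continuousWithinAt
    have hNh : a ≤ a + N * h := by nlinarith
    have hint1 : IntervalIntegrable f volume a (a + N * h) :=
      (hfc.mono hsub).intervalIntegrable_of_Icc hNh
    have hint2 : IntervalIntegrable f volume (a + N * h) (a + (N + 1 : ℕ) * h) :=
      (hfc.mono hsub2).intervalIntegrable_of_Icc hpan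
    rw [← integral_add_adjacent_intervals hint1 hint2, sum_range_succ]
    -- algebra: new error = old error + panel error
    have halg : h • (∑ i ∈ range (N + 1), f (a + i * h) + f (a + ((N + 1 : ℕ) : ℝ) * h)) -
        (h / 2) • (f a + f (a + (N + 1 : ℕ) * h)) -
        ((∫ x in a..(a + N * h), f x) + ∫ x in (a + N * h)..(a + (N + 1 : ℕ) * h), f x) =
        (h • (∑ i ∈ range (N + 1), f (a + i * h)) - (h / 2) • (f a + f (a + N * h)) -
          ∫ x in a..(a + N * h), f x) -
        ((∫ x in (a + N * h)..(a + (N + 1 : ℕ) * h), f x) -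
          (h / 2) • (f (a + N * h) + f (a + (N + 1 : ℕ) * h))) := by
      simp only [smul_add]
      rw [show h • f (a + ((N + 1 : ℕ) : ℝ) * h) = (h / 2) • f (a + ((N + 1 : ℕ) : ℝ) * h) +
        (h / 2) • f (a + ((N + 1 : ℕ) : ℝ) * h) by rw [← add_smul]; ring_nf]
      abel
    rw [halg]
    calc _ ≤ ‖h • (∑ i ∈ range (N + 1), f (a + i * h)) - (h / 2) • (f a + f (a + N * h)) -
            ∫ x in a..(a + N * h), f x‖ +
          ‖(∫ x in (a + N * h)..(a + (N + 1 : ℕ) * h), f x) -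
            (h / 2) • (f (a + N * h) + f (a + (N + 1 : ℕ) * h))‖ := norm_sub_le _ _
      _ ≤ N * (ζ * h ^ 3 / 12) + ζ * h ^ 3 / 12 := add_le_add ih' hstep
      _ = (N + 1 : ℕ) * (ζ * h ^ 3 / 12) := by push_cast; ring

end Literature.Analysis.Calculus
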